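import Literature.AlgebraicTopology.Homotopy.FibreBundlesCubes
import Literature.AlgebraicTopology.Homotopy.CubeHomotopyExtension
import Literature.AlgebraicTopology.Homotopy.StrongDeformationRetract
import HarnessLib

/-!
# Fibre bundles over an attached cell: geometric preliminaries

Topic `Literature/AlgebraicTopology/Homotopy`. Preliminaries for the computation of
`H_•(p⁻¹(Y ∪ ē), p⁻¹Y)` for a fibre bundle `p : E → X` and a closed `n`-cell `ē = Φ(𝔹ⁿ)` attached
to a closed `Y ⊆ X` along its boundary sphere (E. H. Spanier, *Algebraic Topology* (1981), Ch. 9,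
Sec. 2, Lemma 2 and Thm. 15 (a): "`ψ_* : H_s(e, ė; Hₙ(F)) ≈ H_{n+s}(p⁻¹(e), p⁻¹(ė))` … it suffices
to prove the result for a trivial fibration over `Eˢ`", the `E¹`-term of the spectral sequence of a
fibration; A. Hatcher, *Algebraic Topology* (2002), Lemma 2.34 (a) for the base alone), a brick of
the printed proof of `Literature.AlgebraicTopology.Homotopy.Spanier1981_eulerChar_fibreBundle`.
The cells are those of Mathlib's classical CW complexes: `Φ : (Fin n → ℝ) → X` continuous on the
closed unit ball `𝔹ⁿ` of the sup norm, injective on the open ball, boundary sphere into `Y`.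
All PROVED:

* `closedBallHomeomorphCube` — `𝔹ⁿ ≃ₜ Iⁿ` (sup norm), matching the sphere with `∂Iⁿ`
  (`CubeHEP.cubeToBall`);
* `IsFibreBundleWith.exists_homeomorph_prod_of_homeomorph_cube` — a fibre bundle over a base
  homeomorphic to a cube is trivial (from `exists_homeomorph_prod_of_cube`);
* `isStrongDeformationRetractOf_union_image_collar` — **the thickening `Y ∪ Φ(ρ ≤ ‖x‖ ≤ 1)`
  strongly deformation retracts onto `Y`** (Hatcher 2002, proof of Lemma 2.34 / Prop. 2.22:
  radial deformation of the collar, descended along the quotient map `Φ` — only the sphere,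
  where the deformation is stationary, is identified);
* `isStrongDeformationRetractOf_collar_prod` — in `𝔹ⁿ × F`, the collar `(ρ ≤ ‖x‖) × F` strongly
  deformation retracts onto the sphere `(‖x‖ = 1) × F`.

## References

* E. H. Spanier, *Algebraic Topology*, Springer (1981), Ch. 9, Sec. 2, Lemma 2, Thm. 15 (a).
  [Spanier1981]
* A. Hatcher, *Algebraic Topology*, CUP (2002), §2.2 Lemma 2.34, §2.1 Prop. 2.22. [HatcherAT2002]
-/

noncomputable section

open scoped unitInterval
open Function Set Metric
open _root_.Topology

namespace Literature.AlgebraicTopology.Homotopy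

universe u v w

/-! ### The closed sup-norm ball is a cube -/

/-- **`𝔹ⁿ ≃ₜ Iⁿ`**: the closed unit ball of `Fin n → ℝ` (sup norm) and the cube, through
`CubeHEP.ballToCube` / `CubeHEP.cubeToBall` (`v ↦ (v + 1)/2`). [folklore] -/
def closedBallHomeomorphCube (n : ℕ) : ↥(closedBall (0 : Fin n → ℝ) 1) ≃ₜ (Fin n → I) where
  toFun v := CubeHEP.ballToCube v.1
  invFun y := ⟨CubeHEP.cubeToBall y, CubeHEP.cubeToBall_mem_closedBall y⟩
  left_inv v := Subtype.ext (CubeHEP.cubeToBall_ballToCube v.2)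
  right_inv y := CubeHEP.ballToCube_cubeToBall y
  continuous_toFun := CubeHEP.continuous_ballToCube.comp continuous_subtype_val
  continuous_invFun := CubeHEP.continuous_cubeToBall.subtype_mk _

/-- `closedBallHomeomorphCube` matches the unit sphere with the boundary of the cube. [folklore] -/
theorem closedBallHomeomorphCube_symm_mem_sphere_iff {n : ℕ} (y : Fin n → I) :
    (((closedBallHomeomorphCube n).symm y : ↥(closedBall (0 : Fin n → ℝ) 1)) : Fin n → ℝ) ∈
      sphere (0 : Fin n → ℝ) 1 ↔ y ∈ Cube.boundary (Fin n) := by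
  rw [mem_sphere_zero_iff_norm, CubeHEP.mem_boundary_iff_norm_cubeToBall]
  rfl

/-- The same matching read on the ball: `‖v‖ = 1 ↔ ballToCube v ∈ ∂Iⁿ`. [folklore] -/
theorem norm_eq_one_iff_closedBallHomeomorphCube_mem_boundary {n : ℕ}
    (v : ↥(closedBall (0 : Fin n → ℝ) 1)) :
    ‖(v : Fin n → ℝ)‖ = 1 ↔ closedBallHomeomorphCube n v ∈ Cube.boundary (Fin n) := by
  rw [← closedBallHomeomorphCube_symm_mem_sphere_iff, Homeomorph.symm_apply_apply,
    mem_sphere_zero_iff_norm]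

/-! ### Bundles over bases homeomorphic to a cube are trivial -/

namespace IsFibreBundleWith

variable {E : Type u} {B : Type v} {F : Type w} [TopologicalSpace E] [TopologicalSpace B]
  [TopologicalSpace F] {q : E → B}

/-- **A fibre bundle over a base homeomorphic to a cube is trivial**: a homeomorphism
`E ≃ₜ B × F` over `B` (pull back along `θ⁻¹ : Iⁿ → B`, identify the total spaces, apply
`exists_homeomorph_prod_of_cube`). [folklore] -/
theorem exists_homeomorph_prod_of_homeomorph_cube {n : ℕ} (hq : IsFibreBundleWith F q)
    (θ : B ≃ₜ (Fin n → I)) : ∃ e : E ≃ₜ B × F, ∀ y, (e y).1 = q y := by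
  -- the pullback along `θ⁻¹` has total space homeomorphic to `E`
  have hpb := hq.pullback (θ.symm : C((Fin n → I), B))
  let φ : E ≃ₜ (⇑(θ.symm : C((Fin n → I), B))).Pullback q :=
    { toFun := fun y => ⟨(θ (q y), y), θ.symm_apply_apply (q y)⟩
      invFun := fun z => z.snd
      left_inv := fun y => rfl
      right_inv := fun z => by
        apply Subtype.ext
        refine Prod.ext ?_ rfl
        show θ (q z.val.2) = z.val.1
        have hz : θ.symm z.val.1 = q z.val.2 := z.2
        rw [← hz, Homeomorph.apply_symm_apply]
      continuous_toFun := ((θ.continuous.comp hq.continuous).prodMk continuous_id).subtype_mk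
        fun y => θ.symm_apply_apply (q y)
      continuous_invFun := continuous_snd.comp continuous_subtype_val }
  have hcube : IsFibreBundleWith F (Function.Pullback.fst ∘ φ) := hpb.comp_homeomorph φ
  have hfun : (Function.Pullback.fst ∘ φ : E → (Fin n → I)) = θ ∘ q := rfl
  rw [hfun] at hcube
  obtain ⟨e, he⟩ := hcube.exists_homeomorph_prod_of_cube
  refine ⟨e.trans (θ.symm.prodCongr (Homeomorph.refl F)), fun y => ?_⟩
  show θ.symm (e y).1 = q y
  rw [he]
  exact θ.symm_apply_apply (q y)

end IsFibreBundleWith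

/-! ### The thickening of `Y` by a collar of the cell retracts onto `Y` -/

section Collar

variable {n : ℕ}

variable {ρ : ℝ}

/-- The radial deformation of the collar `ρ ≤ ‖x‖ ≤ 1` (`0 < ρ ≤ 1`) onto the unit sphere,
`r(t, x) = (1 - t + t/‖x‖) x`, stays in the collar. [folklore] -/
theorem radial_mem_collar (hρ : 0 < ρ) (hρ1 : ρ ≤ 1) (t : I) {x : Fin n → ℝ}
    (hx : ρ ≤ ‖x‖ ∧ ‖x‖ ≤ 1) :
    ρ ≤ ‖((1 - (t : ℝ)) + t / ‖x‖) • x‖ ∧ ‖((1 - (t : ℝ)) + t / ‖x‖) • x‖ ≤ 1 := by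
  have hpos : 0 < ‖x‖ := lt_of_lt_of_le hρ hx.1
  have h1 : 0 ≤ 1 - (t : ℝ) := by linarith [t.2.2]
  have hcoef : 0 ≤ (1 - (t : ℝ)) + t / ‖x‖ := by
    have := t.2.1
    positivity
  have hnorm : ‖((1 - (t : ℝ)) + t / ‖x‖) • x‖ = (1 - (t : ℝ)) * ‖x‖ + t := by
    rw [norm_smul, Real.norm_eq_abs, abs_of_nonneg hcoef, add_mul, div_mul_cancel₀ _ hpos.ne']
  rw [hnorm]
  constructor
  · nlinarith [t.2.1, t.2.2, hx.1, mul_nonneg h1 (sub_nonneg.2 hx.1),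
      mul_nonneg t.2.1 (sub_nonneg.2 hρ1)]
  · nlinarith [t.2.1, t.2.2, hx.2, mul_nonneg h1 (sub_nonneg.2 hx.2)]

/-- At time `1` the radial deformation lands on the unit sphere. [folklore] -/
theorem norm_radial_one (hρ : 0 < ρ) {x : Fin n → ℝ} (hx : ρ ≤ ‖x‖) :
    ‖((1 - ((1 : I) : ℝ)) + (1 : I) / ‖x‖) • x‖ = 1 := by
  have hpos : 0 < ‖x‖ := lt_of_lt_of_le hρ hx
  rw [norm_smul, Real.norm_eq_abs]
  simp only [Set.Icc.coe_one, sub_self, zero_add, one_div]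
  rw [abs_of_pos (inv_pos.2 hpos), inv_mul_cancel₀ hpos.ne']

/-- On the unit sphere the radial deformation is stationary. [folklore] -/
theorem radial_of_norm_eq_one (t : I) {x : Fin n → ℝ} (hx : ‖x‖ = 1) :
    ((1 - (t : ℝ)) + t / ‖x‖) • x = x := by
  rw [hx, div_one, sub_add_cancel, one_smul]

/-- **The thickening `Y ∪ Φ(ρ ≤ ‖x‖ ≤ 1)` strongly deformation retracts onto `Y`** (`0 < ρ ≤ 1`;
Hatcher 2002, proof of Lemma 2.34 (a) via Prop. 2.22, "`Xⁿ⁻¹` is a deformation retract of `Xⁿ`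
minus a point in each cell", here with a collar of one cell): `X` Hausdorff, `Y` closed,
`Φ : ℝⁿ → X` continuous on the closed unit ball, injective on the open ball, with
`Φ(‖x‖ = 1) ⊆ Y` and `Φ(‖x‖ < 1) ∩ Y = ∅`. The radial deformation of the collar descends along
`Φ`, which on the collar is a quotient map (closed: compact source, Hausdorff target)
identifying only points of the sphere, where the deformation is stationary.
[cite: HatcherAT2002, Lemma 2.34 (a) (proof) and Prop. 2.22] -/
theorem isStrongDeformationRetractOf_union_image_collar {X : Type v} [TopologicalSpace X]
    [T2Space X] {Y : Set X} (hY : IsClosed Y) (Φ : (Fin n → ℝ) → X)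
    (hΦ : ContinuousOn Φ (closedBall 0 1)) (hinj : InjOn Φ (ball 0 1))
    (hsph : ∀ x : Fin n → ℝ, ‖x‖ = 1 → Φ x ∈ Y) (hdisj : ∀ x : Fin n → ℝ, ‖x‖ < 1 → Φ x ∉ Y)
    (hρ : 0 < ρ) (hρ1 : ρ ≤ 1) :
    IsStrongDeformationRetractOf Y (Y ∪ Φ '' {x | ρ ≤ ‖x‖ ∧ ‖x‖ ≤ 1}) := by
  classical
  set C : Set (Fin n → ℝ) := {x | ρ ≤ ‖x‖ ∧ ‖x‖ ≤ 1} with hC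
  set A' : Set X := Y ∪ Φ '' C with hA'
  have hCsub : C ⊆ closedBall (0 : Fin n → ℝ) 1 := fun x hx => mem_closedBall_zero_iff.2 hx.2
  have hCclosed : IsClosed C := by
    have : C = (fun x : Fin n → ℝ => ‖x‖) ⁻¹' Icc ρ 1 := by
      ext x; simp [hC, mem_Icc]
    rw [this]; exact isClosed_Icc.preimage continuous_norm
  have hCcpt : IsCompact C := (isCompact_closedBall (0 : Fin n → ℝ) 1).of_isClosed_subset hCclosed hCsub
  haveI : CompactSpace ↥C := isCompact_iff_compactSpace.1 hCcpt
  -- the radial deformation on the collar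
  let r : I × ↥C → ↥C := fun q =>
    ⟨((1 - (q.1 : ℝ)) + q.1 / ‖(q.2 : Fin n → ℝ)‖) • (q.2 : Fin n → ℝ),
      radial_mem_collar hρ hρ1 q.1 q.2.2⟩
  have hv : Continuous fun q : I × ↥C => (q.2 : Fin n → ℝ) :=
    continuous_subtype_val.comp continuous_snd
  have hc : Continuous fun q : I × ↥C => (1 - (q.1 : ℝ)) + q.1 / ‖(q.2 : Fin n → ℝ)‖ := by
    refine Continuous.add ?_ ?_
    · exact continuous_const.sub (continuous_subtype_val.comp continuous_fst)
    · refine (continuous_subtype_val.comp continuous_fst).div (continuous_norm.comp hv) fun q => ?_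
      exact (lt_of_lt_of_le hρ q.2.2.1).ne'
  have hr : Continuous r := (hc.smul hv).subtype_mk _
  -- the model deformation `G = Φ ∘ r`
  let G : I × ↥C → X := fun q => Φ (r q)
  have hG : Continuous G :=
    hΦ.comp_continuous (continuous_subtype_val.comp hr) fun q => hCsub (r q).2
  -- the chosen preimage in the collar of a point of `Φ(C) ∖ Y`
  have hpre : ∀ a : ↥A', (a : X) ∉ Y → ∃ x, x ∈ C ∧ Φ x = a := fun a ha =>
    (a.2.resolve_left ha).imp fun x hx => ⟨hx.1, hx.2⟩
  let pre : ∀ a : ↥A', (a : X) ∉ Y → ↥C := fun a ha =>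
    ⟨Classical.choose (hpre a ha), (Classical.choose_spec (hpre a ha)).1⟩
  have hpreΦ : ∀ (a : ↥A') (ha : (a : X) ∉ Y), Φ (pre a ha) = a := fun a ha =>
    (Classical.choose_spec (hpre a ha)).2
  -- points of `C` mapped outside `Y` are in the open ball, hence determined by their image
  have hball : ∀ x ∈ C, Φ x ∉ Y → ‖x‖ < 1 := fun x hx hxY =>
    lt_of_le_of_ne hx.2 fun h => hxY (hsph x h)
  have hpre_eq : ∀ (a : ↥A') (ha : (a : X) ∉ Y) (x : ↥C), Φ x = a → pre a ha = x :=
      fun a ha x hxa => by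
    apply Subtype.ext
    have hxY : Φ x ∉ Y := by rw [hxa]; exact ha
    apply hinj (mem_ball_zero_iff.2 (hball _ (pre a ha).2 (by rw [hpreΦ a ha]; exact ha)))
      (mem_ball_zero_iff.2 (hball _ x.2 hxY))
    show Φ (pre a ha) = Φ x
    rw [hpreΦ a ha, hxa]
  -- the deformation of the thickening
  let Hval : I × ↥A' → X := fun q =>
    if hq : (q.2 : X) ∈ Y then (q.2 : X) else Φ (r (q.1, pre q.2 hq))
  have hHval_mem : ∀ q, Hval q ∈ A' := fun q => by
    by_cases hq : (q.2 : X) ∈ Y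
    · simp only [Hval, dif_pos hq]; exact Or.inl hq
    · simp only [Hval, dif_neg hq]; exact Or.inr ⟨_, (r _).2, rfl⟩
  -- on the image of the collar, `Hval` is the descent of `G`
  have hHval_G : ∀ (t : I) (x : ↥C), Hval (t, ⟨Φ x, Or.inr ⟨x, x.2, rfl⟩⟩) = G (t, x) := fun t x => by
    by_cases hx : Φ x ∈ Y
    · have h1 : ‖(x : Fin n → ℝ)‖ = 1 := by
        by_contra h
        exact hdisj x (lt_of_le_of_ne x.2.2 h) hx
      simp only [Hval, dif_pos hx]
      show Φ x = Φ _
      congr 1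
      exact (radial_of_norm_eq_one t h1).symm
    · simp only [Hval, dif_neg hx]
      show Φ (r (t, pre ⟨Φ x, _⟩ hx)) = Φ (r (t, x))
      rw [hpre_eq ⟨Φ x, Or.inr ⟨x, x.2, rfl⟩⟩ hx x rfl]
  -- continuity: on the `Y`-part it is the projection, on the collar part a descent through `Φ`
  have hcont : Continuous Hval := by
    have hS₁ : IsClosed {q : I × ↥A' | (q.2 : X) ∈ Y} :=
      hY.preimage (continuous_subtype_val.comp continuous_snd)
    have hS₂ : IsClosed {q : I × ↥A' | (q.2 : X) ∈ Φ '' C} :=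
      (hCcpt.image_of_continuousOn (hΦ.mono hCsub)).isClosed.preimage
        (continuous_subtype_val.comp continuous_snd)
    have hcover : {q : I × ↥A' | (q.2 : X) ∈ Y} ∪ {q : I × ↥A' | (q.2 : X) ∈ Φ '' C} = univ :=
      eq_univ_of_forall fun q => q.2.2
    rw [← continuousOn_univ, ← hcover]
    refine ContinuousOn.union_of_isClosed ?_ ?_ hS₁ hS₂
    · exact (continuous_subtype_val.comp continuous_snd).continuousOn.congr
        fun q hq => by
          show Hval q = (q.2 : X)
          simp only [Hval, dif_pos (show (q.2 : X) ∈ Y from hq)]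
    · rw [continuousOn_iff_continuous_restrict]
      -- the quotient map `I × C → {q | q.2 ∈ Φ(C)}`
      let π : I × ↥C → ↥{q : I × ↥A' | (q.2 : X) ∈ Φ '' C} := fun q =>
        ⟨(q.1, ⟨Φ q.2, Or.inr ⟨q.2, q.2.2, rfl⟩⟩), ⟨q.2, q.2.2, rfl⟩⟩
      have hπc : Continuous π := by
        refine Continuous.subtype_mk (continuous_fst.prodMk (Continuous.subtype_mk ?_ _)) _
        exact hΦ.comp_continuous (continuous_subtype_val.comp continuous_snd) fun q => hCsub q.2.2
      have hπs : Surjective π := by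
        rintro ⟨⟨t, a⟩, ⟨x, hxC, hxa⟩⟩
        refine ⟨(t, ⟨x, hxC⟩), Subtype.ext (Prod.ext rfl (Subtype.ext hxa))⟩
      have hπq : IsQuotientMap π := (hπc.isClosedMap).isQuotientMap hπc hπs
      rw [hπq.continuous_iff]
      have hcomp : (({q : I × ↥A' | (q.2 : X) ∈ Φ '' C}).restrict Hval) ∘ π = G := by
        funext q
        exact hHval_G q.1 q.2
      rw [hcomp]
      exact hG
  refine ⟨⟨fun q => ⟨Hval q, hHval_mem q⟩, hcont.subtype_mk _⟩, fun a => ?_, fun a => ?_,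
    fun t a ha => ?_⟩
  · -- starts at the identity
    apply Subtype.ext
    show Hval (0, a) = a
    by_cases ha : (a : X) ∈ Y
    · simp only [Hval, dif_pos ha]
    · simp only [Hval, dif_neg ha]
      show Φ (((1 - ((0 : I) : ℝ)) + (0 : I) / ‖(pre a ha : Fin n → ℝ)‖) • (pre a ha : Fin n → ℝ)) = a
      simp only [Set.Icc.coe_zero, sub_zero, zero_div, add_zero, one_smul]
      exact hpreΦ a ha
  · -- ends in `Y`
    show Hval (1, a) ∈ Y
    by_cases ha : (a : X) ∈ Y
    · simp only [Hval, dif_pos ha]; exact ha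
    · simp only [Hval, dif_neg ha]
      exact hsph _ (norm_radial_one hρ (pre a ha).2.1)
  · -- stationary on `Y`
    apply Subtype.ext
    show Hval (t, a) = a
    simp only [Hval, dif_pos ha]

end Collar

/-! ### The collar of the model ball, times the fibre -/

/-- **In `𝔹ⁿ × F` the collar `(ρ ≤ ‖x‖) × F` strongly deformation retracts onto the sphere
`(‖x‖ = 1) × F`** (`0 < ρ ≤ 1`; radial deformation times the identity of `F`). [folklore] -/
theorem isStrongDeformationRetractOf_collar_prod {n : ℕ} {F : Type w} [TopologicalSpace F]
    {ρ : ℝ} (hρ : 0 < ρ) (hρ1 : ρ ≤ 1) :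
    IsStrongDeformationRetractOf
      ({v : ↥(closedBall (0 : Fin n → ℝ) 1) | ‖(v : Fin n → ℝ)‖ = 1} ×ˢ (univ : Set F))
      ({v : ↥(closedBall (0 : Fin n → ℝ) 1) | ρ ≤ ‖(v : Fin n → ℝ)‖} ×ˢ (univ : Set F)) := by
  set S : Set (↥(closedBall (0 : Fin n → ℝ) 1) × F) :=
    {v : ↥(closedBall (0 : Fin n → ℝ) 1) | ρ ≤ ‖(v : Fin n → ℝ)‖} ×ˢ (univ : Set F) with hS
  have hmemS : ∀ z : ↥S, ρ ≤ ‖(z.1.1 : Fin n → ℝ)‖ ∧ ‖(z.1.1 : Fin n → ℝ)‖ ≤ 1 := fun z =>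
    ⟨z.2.1, mem_closedBall_zero_iff.1 z.1.1.2⟩
  let H : I × ↥S → ↥S := fun q =>
    ⟨(⟨((1 - (q.1 : ℝ)) + q.1 / ‖(q.2.1.1 : Fin n → ℝ)‖) • (q.2.1.1 : Fin n → ℝ),
        mem_closedBall_zero_iff.2 (radial_mem_collar hρ hρ1 q.1 (hmemS q.2)).2⟩, q.2.1.2),
      ⟨(radial_mem_collar hρ hρ1 q.1 (hmemS q.2)).1, mem_univ _⟩⟩
  have hv : Continuous fun q : I × ↥S => (q.2.1.1 : Fin n → ℝ) :=
    continuous_subtype_val.comp (continuous_fst.comp (continuous_subtype_val.comp continuous_snd))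
  have hc : Continuous fun q : I × ↥S => (1 - (q.1 : ℝ)) + q.1 / ‖(q.2.1.1 : Fin n → ℝ)‖ := by
    refine Continuous.add ?_ ?_
    · exact continuous_const.sub (continuous_subtype_val.comp continuous_fst)
    · refine (continuous_subtype_val.comp continuous_fst).div (continuous_norm.comp hv) fun q => ?_
      exact (lt_of_lt_of_le hρ (hmemS q.2).1).ne'
  have hH' : Continuous fun q : I × ↥S =>
      ((1 - (q.1 : ℝ)) + q.1 / ‖(q.2.1.1 : Fin n → ℝ)‖) • (q.2.1.1 : Fin n → ℝ) := hc.smul hv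
  have hH : Continuous H :=
    ((hH'.subtype_mk _).prodMk (continuous_snd.comp (continuous_subtype_val.comp
      continuous_snd))).subtype_mk _
  refine ⟨⟨H, hH⟩, fun z => ?_, fun z => ?_, fun t z hz => ?_⟩
  · apply Subtype.ext
    show ((⟨((1 - ((0 : I) : ℝ)) + (0 : I) / ‖(z.1.1 : Fin n → ℝ)‖) • (z.1.1 : Fin n → ℝ), _⟩, z.1.2) :
      ↥(closedBall (0 : Fin n → ℝ) 1) × F) = z.1
    refine Prod.ext (Subtype.ext ?_) rfl
    show ((1 - ((0 : I) : ℝ)) + (0 : I) / ‖(z.1.1 : Fin n → ℝ)‖) • (z.1.1 : Fin n → ℝ) = z.1.1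
    simp
  · show ((⟨((1 - ((1 : I) : ℝ)) + (1 : I) / ‖(z.1.1 : Fin n → ℝ)‖) • (z.1.1 : Fin n → ℝ), _⟩, z.1.2) :
      ↥(closedBall (0 : Fin n → ℝ) 1) × F) ∈
        {v : ↥(closedBall (0 : Fin n → ℝ) 1) | ‖(v : Fin n → ℝ)‖ = 1} ×ˢ (univ : Set F)
    exact ⟨norm_radial_one hρ (hmemS z).1, mem_univ _⟩
  · apply Subtype.ext
    have hz1 : ‖(z.1.1 : Fin n → ℝ)‖ = 1 := hz.1
    show ((⟨((1 - (t : ℝ)) + t / ‖(z.1.1 : Fin n → ℝ)‖) • (z.1.1 : Fin n → ℝ), _⟩, z.1.2) :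
      ↥(closedBall (0 : Fin n → ℝ) 1) × F) = z.1
    exact Prod.ext (Subtype.ext (radial_of_norm_eq_one t hz1)) rfl

end Literature.AlgebraicTopology.Homotopy
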